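import Mathlib
import Literature.NumberTheory.Transcendental.LinEDS
import Literature.NumberTheory.Transcendental.LinEDSCode
import Literature.NumberTheory.Transcendental.LinEDSCells
import Summits.KontsevichZagierPeriods.KontsevichZagierPeriods.Theorems.FurushoPentagonKernelModuloPeriodConjectureLeafOfCheckBlocksGC
import HarnessLib


/-!
# `KernelModuloPeriodConjecture`, line `Sketch`: the leaf from a chain of CELL block certificates

Crux `FurushoPentagon.KernelModuloPeriodConjecture` (stmt-KontsevichZagierPeriods-15058), line
`Sketch`, lead c7. Block master theorem of the GF(2) rank engine for block certificates over CELLS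
of columns (`LinEDS.checkBlockC`, `LinEDS.chainOK`,
`Literature/NumberTheory/Transcendental/LinEDSCells.lean`): a chain of blocks `(cells, later)`
passing `chainOK` (every later block inside the `later` cells of every earlier block; the blocks
cover `colMask k`), each block certified by `checkBlockC` at some width `W'` with enough fuel,
gives the weight-`k` slice of the algebraic leaf `AssociatorHoffmanSpanning`. The proof is the
compacted block master `stub_leaf_of_checkBlocksGC` (lead c6) with the column bookkeeping done by
the Booleans of the certificate instead of depth arithmetic: the certificate's column list `L` IS
the block (`maskOf L = cellsMask cells ∧ colMask`), block triangularity of the integer matrix comes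
from `rowBitsG ∧ cellsMask later = 0` and the nesting half of `chainOK`, surjectivity onto the
columns from its covering half; the diagonal blocks are odd by E6 at width `W'` on the folded rows,
the compaction lemma `stub_xorFold_testBit` and the group parities, exactly as before. Nothing
about the meaning of a cell is used.

References: K. Ihara, M. Kaneko, D. Zagier, Compos. Math. 142 (2006) §2, Conjecture 1
[IharaKanekoZagier2006]; F. Brown, Ann. of Math. 175 (2012) Thm 1.1 [Brown2012].
-/

namespace Summit.KontsevichZagierPeriods.FurushoPentagon.KernelModuloPeriodConjecture

open Literature.NumberTheory.Transcendental
open Literature.NumberTheory.Transcendental.LinEDS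

/-! ### The unpacked cell block check -/

/-- Unpacking a successful `checkBlockC`. [folklore] -/
theorem blocksC_checkBlockC {k W' f : ℕ} {cells later : List (ℕ × List ℕ)} {L : List ℕ}
    {groups : List (List (List ℕ × List ℕ))}
    (h : LinEDS.checkBlockC k W' f cells later L groups = true) :
    groups.length = L.length ∧
      LinEDS.maskOf L = LinEDS.cellsMask k cells &&& LinEDS.colMask k ∧
      LinEDS.incMod W' L = true ∧ L.length < W' ∧
      (∀ g ∈ groups, ∀ μ ∈ g, LinEDS.validName k μ = true) ∧
      (∀ g ∈ groups, LinEDS.rowBitsG k g &&& LinEDS.cellsMask k later = 0) ∧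
      LinEDS.elimLoop W' (LinEDS.rep W' L.length) (L.map (· % W'))
        (LinEDS.pack W' ((groups.map (LinEDS.rowBitsG k)).map fun r =>
          LinEDS.xorFold W' f (r &&& (LinEDS.cellsMask k cells &&& LinEDS.colMask k)))) = true := by
  simp only [LinEDS.checkBlockC, Bool.and_eq_true, List.all_eq_true, List.mem_map,
    forall_exists_index, and_imp, forall_apply_eq_imp_iff₂, beq_iff_eq, Nat.blt_eq,
    LinEDS.lengthTR_eq] at h
  obtain ⟨⟨⟨⟨⟨⟨hlen, hmask⟩, hinc⟩, hlt⟩, hval⟩, hno⟩, helim⟩ := h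
  exact ⟨Nat.eq_of_beq_eq_true hlen, Nat.eq_of_beq_eq_true hmask, hinc, hlt, hval, hno, helim⟩

/-- The column mask is below `2^2^(k-1)` (its bits are codes `< 2^(k-1)`). [folklore] -/
theorem blocksC_colMask_lt {k : ℕ} (hk : 2 ≤ k) : LinEDS.colMask k < 2 ^ 2 ^ (k - 1) := by
  obtain ⟨-, hcols, -, hcm⟩ := stub_cols_spec k hk
  refine Nat.lt_pow_two_of_testBit _ fun i hi => ?_
  cases hb : (LinEDS.colMask k).testBit i
  · rfl
  · have := ((hcols i).mp ((hcm i).mp hb)).1; omega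

/-- A member of the certificate's column list is a column of the engine. [folklore] -/
theorem blocksC_mem_cols {k : ℕ} (hk : 2 ≤ k) {cells : List (ℕ × List ℕ)} {L : List ℕ}
    (hmask : LinEDS.maskOf L = LinEDS.cellsMask k cells &&& LinEDS.colMask k) {c : ℕ} (hc : c ∈ L) :
    c ∈ LinEDS.cols k := by
  obtain ⟨-, -, -, hcm⟩ := stub_cols_spec k hk
  have hb := (blocksE13_testBit_maskOf L c).mpr hc
  rw [hmask, Nat.testBit_land, Bool.and_eq_true] at hb
  exact (hcm c).mp hb.2

/-! ### One block: its diagonal integer block has odd determinant -/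

/-- **The diagonal block of a cell certificate is odd**: the integer matrix of its groups against
its listed columns has odd determinant (E6 at width `W'` on the folded rows, the compaction
lemma, group parities, E7 (a)). [cite: IharaKanekoZagier2006, §2] -/
theorem blocksC_diag_odd {k W' f : ℕ} (hk : 2 ≤ k) {cells later : List (ℕ × List ℕ)} {L : List ℕ}
    {groups : List (List (List ℕ × List ℕ))}
    (h : LinEDS.checkBlockC k W' f cells later L groups = true) (hfuel : 2 ^ (k - 1) ≤ W' * (f + 1))
    (hlen : L.length = groups.length) :
    Odd (Matrix.of fun (x y : Fin L.length) =>
      LinEDS.entryG k (groups.get (Fin.cast hlen x)) (L.get y)).det := by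
  classical
  obtain ⟨-, hmask, hinc, hlt, hval, -, helim⟩ := blocksC_checkBlockC h
  set mask := LinEDS.cellsMask k cells &&& LinEDS.colMask k with hmaskdef
  have hpwL : (L.map (· % W')).Pairwise (· < ·) := ((LinEDS.incMod_eq_true_iff L).mp hinc).pairwise
  have hW : 0 < W' := by omega
  -- the folded rows and E6 at width W'
  set rows := (groups.map (LinEDS.rowBitsG k)).map fun r => LinEDS.xorFold W' f (r &&& mask) with hrows
  have hrowlt : ∀ r ∈ rows, r < 2 ^ W' := by
    intro r hr
    obtain ⟨r', -, rfl⟩ := List.mem_map.mp hr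
    exact LinEDS.xorFold_lt f _
  have hrowslen : rows.length = L.length := by simp [hrows, hlen]
  have hcolslt : ∀ c ∈ L.map (· % W'), c < W' := by
    intro c hc
    obtain ⟨c', -, rfl⟩ := List.mem_map.mp hc
    exact Nat.mod_lt _ hW
  have hpiv := stub_elimLoop_sound W' rows (L.map (· % W')) hW hrowlt hcolslt
    (by rw [hrowslen]; exact helim)
  -- E7 (a)
  let row : Fin L.length → ℕ := fun x =>
    LinEDS.xorFold W' f (LinEDS.rowBitsG k (groups.get (Fin.cast hlen x)) &&& mask)
  have hofFn : List.ofFn row = rows := by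
    rw [hrows, List.map_map]
    exact blocksE13_ofFn_get groups ((fun r => LinEDS.xorFold W' f (r &&& mask)) ∘ LinEDS.rowBitsG k) hlen
  let col : Fin L.length → ℕ := fun y => L.get y % W'
  have hcolget : ∀ y, col y = (L.map (· % W')).get (Fin.cast (by simp) y) := fun y => by
    simp [col]
  have hmono : StrictMono col := by
    intro x y hxy
    rw [hcolget, hcolget]
    exact List.pairwise_iff_get.mp hpwL _ _ hxy
  refine stub_oddDet_and_solve.1 L.length row col hmono
    (fun y => hofFn ▸ hpiv (col y) (by rw [hcolget]; exact List.get_mem _ _)) _ fun x y => ?_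
  -- parities
  have hyL : L.get y ∈ L := List.get_mem _ _
  rw [Matrix.of_apply, ← blocksG_rowBitsG_parity (hval _ (List.get_mem _ _)) (blocksC_mem_cols hk hmask hyL)]
  show _ ↔ (LinEDS.xorFold W' f (LinEDS.rowBitsG k (groups.get (Fin.cast hlen x)) &&& mask)).testBit
    (L.get y % W') = true
  have hsupp : ∀ i, (LinEDS.rowBitsG k (groups.get (Fin.cast hlen x)) &&& mask).testBit i = true → i ∈ L := by
    intro i hi
    rw [Nat.testBit_land, Bool.and_eq_true] at hi
    exact (blocksE13_testBit_maskOf L i).mp (hmask ▸ hi.2)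
  have hinj : ∀ a ∈ L, ∀ b ∈ L, a % W' = b % W' → a = b :=
    List.inj_on_of_nodup_map (hpwL.imp fun {a b} (h : a < b) => ne_of_lt h)
  have hmasklt : mask < 2 ^ 2 ^ (k - 1) :=
    lt_of_le_of_lt Nat.and_le_right (blocksC_colMask_lt hk)
  have hsize : LinEDS.rowBitsG k (groups.get (Fin.cast hlen x)) &&& mask < 2 ^ (W' * (f + 1)) :=
    lt_of_lt_of_le (lt_of_le_of_lt Nat.and_le_right hmasklt) (Nat.pow_le_pow_right (by norm_num) hfuel)
  have hmaskbit : mask.testBit (L.get y) = true := by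
    rw [← hmask]; exact (blocksE13_testBit_maskOf L _).mpr hyL
  rw [stub_xorFold_testBit W' f _ _ L hW hsize hsupp hyL hinj, Nat.testBit_land, hmaskbit, Bool.and_true]

/-! ### The registered stub -/

/-- **The leaf from a chain of cell block certificates** (registered stub
`stub_leaf_of_checkBlocksC`, lead c7; crux stmt-KontsevichZagierPeriods-15058, line `Sketch`):
a chain `bl` of blocks `(cells, later)` with `chainOK k bl`, each certified by
`LinEDS.checkBlockC` at some width `W'` with enough fuel (`2^(k-1) ≤ W'(f+1)`, so the fold is
complete) ⇒ the weight-`k` slice of the algebraic leaf. [cite: IharaKanekoZagier2006, Conjecture 1] -/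
theorem stub_leaf_of_checkBlocksC :
    ∀ (k : ℕ) (bl : List (List (ℕ × List ℕ) × List (ℕ × List ℕ))), 2 ≤ k →
      LinEDS.chainOK k bl = true →
      (∀ p ∈ bl, ∃ (W' f : ℕ) (L : List ℕ) (groups : List (List (List ℕ × List ℕ))),
        2 ^ (k - 1) ≤ W' * (f + 1) ∧ LinEDS.checkBlockC k W' f p.1 p.2 L groups = true) →
      ∀ s : List ℕ, MZV.IsAdmissible s → MZV.weight s = k →
        ∃ b : List ℕ →₀ ℚ, (∀ t ∈ b.support, MZV.IsHoffman t ∧ MZV.weight t = MZV.weight s) ∧ ∀ (R : Type) [CommRing R] [Algebra ℚ R] [IsReduced R] (φ : NCSeries Bool R), NCSeries.IsGroupLike φ → NCSeries.DrinfeldPentagon φ → φ (MZV.binaryWord s) = b.sum (fun t q => q • φ (MZV.binaryWord t)) := by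
  classical
  intro k bl hk hchain hblocks s hs hw
  choose Wq fq Lq nm hfuel hnm using hblocks
  -- the chain condition
  have hch := hchain
  simp only [LinEDS.chainOK, Bool.and_eq_true] at hch
  obtain ⟨hnest, hcover'⟩ := hch
  have hcover := Nat.eq_of_beq_eq_true hcover'
  set ms := bl.map fun p => (LinEDS.cellsMask k p.1 &&& LinEDS.colMask k, LinEDS.cellsMask k p.2)
    with hms
  set B := bl.length with hB
  have hmsl : ms.length = B := by simp [hms, hB]
  have hmsget : ∀ β : Fin B, ms.get (Fin.cast hmsl.symm β) =
      (LinEDS.cellsMask k (bl.get β).1 &&& LinEDS.colMask k, LinEDS.cellsMask k (bl.get β).2) := by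
    intro β; simp [hms]
  have hmemβ : ∀ β : Fin B, bl.get β ∈ bl := fun β => List.get_mem _ _
  let W' : Fin B → ℕ := fun β => Wq (bl.get β) (hmemβ β)
  let fu : Fin B → ℕ := fun β => fq (bl.get β) (hmemβ β)
  let L : Fin B → List ℕ := fun β => Lq (bl.get β) (hmemβ β)
  let groups : Fin B → List (List (List ℕ × List ℕ)) := fun β => nm (bl.get β) (hmemβ β)
  have hchk : ∀ β, LinEDS.checkBlockC k (W' β) (fu β) (bl.get β).1 (bl.get β).2 (L β) (groups β) = true :=
    fun β => hnm _ _
  have hfu : ∀ β, 2 ^ (k - 1) ≤ W' β * (fu β + 1) := fun β => hfuel _ _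
  let nb : Fin B → ℕ := fun β => (L β).length
  have hlen : ∀ β, (L β).length = (groups β).length := fun β => ((blocksC_checkBlockC (hchk β)).1).symm
  have hmask : ∀ β, LinEDS.maskOf (L β) = LinEDS.cellsMask k (bl.get β).1 &&& LinEDS.colMask k :=
    fun β => (blocksC_checkBlockC (hchk β)).2.1
  -- positions, groups and columns
  let ν : (Σ β : Fin B, Fin (nb β)) → List (List ℕ × List ℕ) :=
    fun i => (groups i.1).get (Fin.cast (hlen i.1) i.2)
  let col : (Σ β : Fin B, Fin (nb β)) → ℕ := fun j => (L j.1).get j.2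
  have hvalid : ∀ i, ∀ μ ∈ ν i, LinEDS.validName k μ = true :=
    fun i => (blocksC_checkBlockC (hchk i.1)).2.2.2.2.1 _ (List.get_mem _ _)
  have hcolL : ∀ j, col j ∈ L j.1 := fun j => List.get_mem _ _
  have hcolmem : ∀ j, col j ∈ LinEDS.cols k := fun j => blocksC_mem_cols hk (hmask j.1) (hcolL j)
  obtain ⟨-, -, -, hcm⟩ := stub_cols_spec k hk
  -- every column lies in a block (the covering half of `chainOK`)
  have hcolsurj : ∀ c ∈ LinEDS.cols k, ∃ j, col j = c := by
    intro c hc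
    have hbit : (LinEDS.orAll (ms.map Prod.fst)).testBit c = true := by rw [hcover]; exact (hcm c).mpr hc
    obtain ⟨m, hm, hmc⟩ := (LinEDS.testBit_orAll c _).mp hbit
    obtain ⟨q, hq, rfl⟩ := List.mem_map.mp hm
    obtain ⟨p, hp, rfl⟩ := List.mem_map.mp hq
    obtain ⟨β', hβ'⟩ := List.mem_iff_get.mp hp
    let β : Fin B := Fin.cast rfl β'
    have hpβ : p = bl.get β := hβ'.symm
    subst hpβ
    have hcL : c ∈ L β := by
      rw [← blocksE13_testBit_maskOf, hmask β]; exact hmc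
    obtain ⟨y, hy⟩ := List.mem_iff_get.mp hcL
    exact ⟨⟨β, y⟩, hy⟩
  -- nesting: a later block's columns lie in the `later` cells of an earlier block
  have hsub : ∀ β β' : Fin B, β < β' →
      (LinEDS.cellsMask k (bl.get β').1 &&& LinEDS.colMask k) &&& LinEDS.cellsMask k (bl.get β).2 =
        LinEDS.cellsMask k (bl.get β').1 &&& LinEDS.colMask k := by
    intro β β' hlt'
    have := LinEDS.chainNested_get ms hnest (Fin.cast hmsl.symm β) (Fin.cast hmsl.symm β') hlt'
    rwa [hmsget, hmsget] at this
  -- odd determinant, by blocks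
  have hdet : Odd (Matrix.of fun i j => LinEDS.entryG k (ν i) (col j)).det := by
    refine stub_blockDet_odd B nb _ (fun i j hij => ?_) (fun β => ?_)
    · rw [Matrix.of_apply, ← Int.not_odd_iff_even,
        ← blocksG_rowBitsG_parity (hvalid i) (hcolmem j)]
      -- bit (col j) of the `later` mask of block i.1 is set
      have hlater : (LinEDS.cellsMask k (bl.get i.1).2).testBit (col j) = true := by
        have hb : (LinEDS.cellsMask k (bl.get j.1).1 &&& LinEDS.colMask k).testBit (col j) = true := by
          rw [← hmask j.1]; exact (blocksE13_testBit_maskOf _ _).mpr (hcolL j)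
        rw [← hsub i.1 j.1 hij, Nat.testBit_land, Bool.and_eq_true] at hb
        exact hb.2
      have hzero := (blocksC_checkBlockC (hchk i.1)).2.2.2.2.2.1 _
        (List.get_mem _ (Fin.cast (hlen i.1) i.2))
      have hbit := congrArg (·.testBit (col j)) hzero
      simp only [Nat.testBit_land, Nat.zero_testBit, hlater, Bool.and_true] at hbit
      show ¬ (LinEDS.rowBitsG k (ν i)).testBit (col j) = true
      rw [hbit]; exact Bool.false_ne_true
    · exact blocksC_diag_odd hk (hchk β) (hfu β) (hlen β)
  exact stub_leaf_of_oddDetSum k _ ν col hk hvalid hcolmem hcolsurj hdet s hs hw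

end Summit.KontsevichZagierPeriods.FurushoPentagon.KernelModuloPeriodConjecture
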